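import Literature.AnabelianGeometry.EtaleTheta.Discharge.Sec5Prop55TransportIndependent
import HarnessLib

/-!
# [EtTh] Prop. 5.5 re-assembled WITHOUT the P55-L06 input: functoriality of `ρ₀` along the lifts `s^⊓-gp_N(g)`
# from the Kummer-determined shape, injectivity from P55-L05 (proof-only)

Mochizuki, *The étale theta function and its Frobenioid-theoretic manifestations*, Publ. RIMS **45** (2009)
[EtTh], Prop. 5.5, proof pp.327–328 (PDF pp.101–102) [cite: MochizukiEtTh2009, Prop 5.5 proof p.328 (PDF p.102)].
abc-iut cell, layer L2, sub-DAG `plan/L2/SUBDAG-EtTh-Thm56.md`, leaf **P55-L06** continued (seat abc-iut-w4-d008 g2);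
PROOF-ONLY companion of `Discharge/Sec5Prop55TransportIndependent.lean` (no definition, no new named fact; every
input is a hypothesis binder written out in the signature).

WHAT IS PROVED (namespace `ThetaFrobenioid.Thm56Sub`, abstract §5 datum `𝔉 : ThetaFrobenioid C D`):
* `autFunctorial_sgpCap_of_kummerShape` — the hypothesis (F) of `transportIndependent_of` («the original
  "functoriality" of the isomorphism for `S″`» along the canonical lifts `s^⊓-gp_N(g)`, `g ∈ Aut_D(B_N^bs)`)
  DERIVED for an isomorphism of the Kummer-determined SHAPE `ρ₀([proj h]) = s^⊓-gp_N(h) · s^⊔-gp_N(h)⁻¹`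
  (Prop. 5.2 (iii); abc-iut-L2-t4's `IsKummerDetermined`) from T56-L09d `UnitsPullSpec`, `SgpCapSection`, coverage
  `LDeltaCovered`, and two structural laws: `hproj` (the transport of `(l·Δ_Θ)_{B_N}` along an automorphism `g`
  of `B_N^bs` is transport of structure `σ ↦ g σ g⁻¹` on `Aut_D(B_N^bs) ⊇ P ↠ (l·Δ_Θ)_{B_N}`, p.327) and `hcup`
  (`s^⊔-gp_N(g h g⁻¹) = s^⊓-gp_N(g) · s^⊔-gp_N(h) · s^⊓-gp_N(g)⁻¹` over `(l·Δ_Θ)`, i.e. the bi-Kummer difference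
  cocycle of Prop. 4.3 (iii) is Galois-equivariant on `l·Δ_Θ` — the Galois-equivariance of the étale theta class,
  Prop. 1.3; cf. p.329 (PDF p.103) l.17–21);
* `kummerShape_of_thetaPair` — that shape for the isomorphism `ν` pinned by the Prop. 5.2 (iii) class
  (`ThetaPairKummerClass η ν`, P55-L02 `EtaTautological`, P55-L02b `CyclotomeCentralUnderLDelta`; the computation of
  abc-iut-w5-d020's `isKummerDetermined_of_thetaPair`);
* `lDeltaModNMap_injective_of_reach` — the hypothesis (I) of `transportIndependent_of` DERIVED from P55-L05
  (`BijectivelyReachableFromBN`) + (G) base transitivity + (S) `SgpCapSection` + the laws P55-L06b;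
* `transportIndependent_of_thetaPair` — **P55-L06 `TransportIndependent ν` from structural laws only**;
* `cyclotomicRigidity_of_laws` — **abc-iut-L2-t4's `CyclotomicRigidity P hB` (Prop. 5.5, existence ∧ uniqueness)
  = abc-iut-w5-d020's `cyclotomicRigidity_of_sub` with its input `hind : TransportIndependent ν` DISCHARGED.**
  Named inputs left: the Prop. 5.2 (iii) pin (MERGE-PLAN row 6), P55-L02, P55-L02b, P55-L05, the laws P55-L06b /
  T56-L09d (theorems at `ofModel`: abc-iut-w5-d020 `Discharge/Sec5TransportLaws`), coverage, and the structural laws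
  (G) `hgal`, (S) `hsec`, (U) `hUb` (theorem at `ofModel`: `ofModel_unitsPull_congr_base`), `hproj`, `hcup`.

HONEST FRAMING: kernel-checked implications between typed statements about the abstract §5 data; the structural
laws are hypotheses (what the genuine instance must supply), not asserted; [EtTh] is refereed; typed ≠ discharged;
no side taken on [IUTchIII] Cor. 3.12.
-/

namespace Literature.AnabelianGeometry.EtaleTheta

open CategoryTheory
open FrobenioidCyclotomicRigidity

universe w v v' u u'

namespace ThetaFrobenioid

namespace Thm56Sub

variable {C : Type u} [Category.{v} C] {D : Type u'} [Category.{v'} D] {𝔉 : ThetaFrobenioid.{w} C D}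

/-- `Iso.conjAut β` is conjugation `p ↦ β p β⁻¹` in the group `Aut S`.
[cite: MochizukiEtTh2009, Thm 5.6 proof p.329 (PDF p.103)] -/
theorem conjAut_eq_conj {S : C} (β p : Aut S) : β.conjAut p = β * p * β⁻¹ := by
  rw [Iso.conjAut_apply, Aut.Aut_mul_def, Aut.Aut_mul_def, Aut.Aut_inv_def]

/-- Along an AUTOMORPHISM `β` of `S` the cyclotome pull-back is `m ↦ β⁻¹ m β` (T56-L09d `muTorsionPull_iso_eq`,
from the law `UnitsPullSpec`).  [cite: MochizukiEtTh2009, Thm 5.6 proof p.329 (PDF p.103)] -/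
theorem coe_muTorsionPull_aut (hspec : UnitsPullSpec 𝔉) {S : C} (β : Aut S) (M : ℕ) (m : 𝔉.muTorsion S M) :
    ((𝔉.muTorsionPull β.hom M m : 𝔉.muTorsion S M) : Aut S) = β⁻¹ * (m : Aut S) * β := by
  have hconj := muTorsionPull_iso_eq (𝔉 := 𝔉) hspec β M m
  rw [conjAut_eq_conj, mul_inv_eq_iff_eq_mul] at hconj
  rw [mul_assoc, eq_inv_mul_iff_mul_eq, hconj]

/-- `Δ-push` along an automorphism is injective (composition and identity laws P55-L06b).
[cite: MochizukiEtTh2009, Prop 5.5 proof p.328 (PDF p.102)] -/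
theorem lDeltaModNMap_aut_injective (hLc : LDeltaMapComp 𝔉) (hLi : LDeltaMapId 𝔉) {S : C} (β : Aut S) :
    Function.Injective (𝔉.lDeltaModNMap β.hom) := by
  intro a b h
  have h' := congrArg (𝔉.lDeltaModNMap β.inv) h
  simp only [← lDeltaModNMap_comp hLc, Iso.hom_inv_id, lDeltaModNMap_id hLi] at h'
  exact h'

/-- **Injectivity (I) DERIVED from P55-L05** («which induce isomorphisms»: abc-iut-L2-t4/w5-d020's
`BijectivelyReachableFromBN`) together with (G) base transitivity and (S) `SgpCapSection`: EVERY linear `φ : B_N ⟶ T`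
to a theta-saturated `T` has the base map of `s^⊓-gp_N(g) ≫ φ_T` for the chosen bijective `φ_T`, hence an
injective (indeed bijective) `Δ-push`.  [cite: MochizukiEtTh2009, Prop 5.5 proof p.328 (PDF p.102)] -/
theorem lDeltaModNMap_injective_of_reach (hLc : LDeltaMapComp 𝔉) (hLi : LDeltaMapId 𝔉) (hsec : 𝔉.SgpCapSection)
    (hgal : ∀ (T : C), 𝔉.IsThetaSaturated T → ∀ (φ φ' : 𝔉.BN ⟶ T), 𝔉.IsLinear φ → 𝔉.IsLinear φ' →
      ∃ g : Aut (𝔉.base.obj 𝔉.BN), 𝔉.base.map φ' = g.hom ≫ 𝔉.base.map φ)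
    (hreach : BijectivelyReachableFromBN 𝔉) (T : C) (hT : 𝔉.IsThetaSaturated T) (φ : 𝔉.BN ⟶ T)
    (hφ : 𝔉.IsLinear φ) : Function.Injective (𝔉.lDeltaModNMap φ) := by
  obtain ⟨φT, hlinT, hΔT, -⟩ := hreach T hT
  obtain ⟨g, hg⟩ := hgal T hT φT φ hlinT hφ
  have hαb : 𝔉.base.map (𝔉.sgpCap g).hom = g.hom := congrArg Iso.hom (hsec g)
  have hb : 𝔉.base.map φ = 𝔉.base.map ((𝔉.sgpCap g).hom ≫ φT) := by
    rw [CategoryTheory.Functor.map_comp, hαb, hg]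
  intro a b h
  rw [lDeltaModNMap_congr_base hb, lDeltaModNMap_congr_base hb, lDeltaModNMap_comp hLc,
    lDeltaModNMap_comp hLc] at h
  exact lDeltaModNMap_aut_injective hLc hLi (𝔉.sgpCap g) (hΔT.1 h)

/-- **Functoriality (F) of `ρ₀` along the lifts `s^⊓-gp_N(g)`, `g ∈ Aut_D(B_N^bs)`, DERIVED from the
Kummer-determined shape** «`ρ₀([proj h]) = s^⊓-gp_N(h) · s^⊔-gp_N(h)⁻¹`» (Prop. 5.2 (iii) / abc-iut-L2-t4's
`IsKummerDetermined`; here the hypothesis `hKD`), given: `hspec` (T56-L09d: pull-back along an isomorphism is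
conjugation), `hsec` (`SgpCapSection`), abc-iut-L2-t11's coverage `hcov` (`LDeltaCovered`), and two structural laws —
`hproj`: the transport of `(l·Δ_Θ)_{B_N}` along an automorphism `g` of `B_N^bs` is induced by transport of structure
`σ ↦ g σ g⁻¹` on `Aut_D(B_N^bs) ⊇ P_{B_N^bs} ↠ (l·Δ_Θ)_{B_N}` (p.327 (PDF p.101): «these subquotients determine
subquotients `Aut_D(D) ↠ Aut^Θ_D(D)`»); `hcup`: `s^⊔-gp_N` is compatible with that conjugation through `s^⊓-gp_N`
on the part over `(l·Δ_Θ)` — `s^⊔-gp_N(g h g⁻¹) = s^⊓-gp_N(g) · s^⊔-gp_N(h) · s^⊓-gp_N(g)⁻¹` (equivalently: the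
bi-Kummer difference cocycle `d = κ` of Prop. 4.3 (iii) satisfies `d(g h g⁻¹) = g ⋆ d(h)` on `(l·Δ_Θ)`, the
Galois-equivariance of the étale theta class restricted to `l·Δ_Θ`, Prop. 1.3; p.329 (PDF p.103) l.17–21).
Computation: `Δ-push(s^⊓_g)[proj h] = [proj (g h g⁻¹)]`, `ρ₀` of it `= s^⊓_g (s^⊓_h s^⊔_h⁻¹) s^⊓_g⁻¹`, and
`μ-pull(s^⊓_g)` conjugates it back.  [cite: MochizukiEtTh2009, Prop 5.5 proof p.328 (PDF p.102)] -/
theorem autFunctorial_sgpCap_of_kummerShape (hspec : UnitsPullSpec 𝔉) (hsec : 𝔉.SgpCapSection)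
    (P : ThetaSubquotientProj 𝔉) (hcov : LDeltaCovered 𝔉 P)
    (ρ₀ : 𝔉.lDeltaModN 𝔉.BN ≃* 𝔉.muTorsion 𝔉.BN 𝔉.N)
    (hKD : ∀ (h : 𝔉.HB) (hh : (h : Aut (𝔉.base.obj 𝔉.BN)) ∈ P.pre (𝔉.base.obj 𝔉.BN)),
      (ρ₀ (QuotientGroup.mk (P.proj _ ⟨h, hh⟩)) : Aut 𝔉.BN) =
        𝔉.sgpCap (h : Aut (𝔉.base.obj 𝔉.BN)) * (𝔉.sgpCup h)⁻¹)
    (hproj : ∀ (g h : Aut (𝔉.base.obj 𝔉.BN)) (hh : h ∈ P.pre (𝔉.base.obj 𝔉.BN)),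
      ∃ hgh : g * h * g⁻¹ ∈ P.pre (𝔉.base.obj 𝔉.BN),
        𝔉.lDeltaMap g.hom (P.proj _ ⟨h, hh⟩) = P.proj _ ⟨g * h * g⁻¹, hgh⟩)
    (hcup : ∀ (g : Aut (𝔉.base.obj 𝔉.BN)) (h : 𝔉.HB),
      (h : Aut (𝔉.base.obj 𝔉.BN)) ∈ P.pre (𝔉.base.obj 𝔉.BN) →
        ∃ hmem : g * (h : Aut (𝔉.base.obj 𝔉.BN)) * g⁻¹ ∈ 𝔉.HB,
          𝔉.sgpCup ⟨g * (h : Aut (𝔉.base.obj 𝔉.BN)) * g⁻¹, hmem⟩ =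
            𝔉.sgpCap g * 𝔉.sgpCup h * (𝔉.sgpCap g)⁻¹)
    (g : Aut (𝔉.base.obj 𝔉.BN)) (x : 𝔉.lDeltaModN 𝔉.BN) :
    𝔉.muTorsionPull (𝔉.sgpCap g).hom 𝔉.N (ρ₀ (𝔉.lDeltaModNMap (𝔉.sgpCap g).hom x)) = ρ₀ x := by
  obtain ⟨h, hh, rfl⟩ := hcov x
  obtain ⟨hgh, hprojEq⟩ := hproj g h hh
  obtain ⟨hmem, hcupEq⟩ := hcup g h hh
  -- the `Δ`-side: `Δ-push(s^⊓-gp_N(g)) [proj h] = [proj (g h g⁻¹)]`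
  have hΔ : 𝔉.lDeltaModNMap (𝔉.sgpCap g).hom (QuotientGroup.mk (P.proj _ ⟨h, hh⟩)) =
      QuotientGroup.mk (P.proj _ ⟨((⟨g * (h : Aut (𝔉.base.obj 𝔉.BN)) * g⁻¹, hmem⟩ : 𝔉.HB) :
        Aut (𝔉.base.obj 𝔉.BN)), hgh⟩) := by
    change QuotientGroup.mk (𝔉.lDeltaMap (𝔉.base.map (𝔉.sgpCap g).hom) (P.proj _ ⟨h, hh⟩)) = _
    have hαb : 𝔉.base.map (𝔉.sgpCap g).hom = g.hom := congrArg Iso.hom (hsec g)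
    rw [hαb, hprojEq]
  rw [hΔ]
  apply Subtype.ext
  rw [coe_muTorsionPull_aut hspec, hKD _ hgh, hKD h hh]
  change (𝔉.sgpCap g)⁻¹ * (𝔉.sgpCap (g * (h : Aut (𝔉.base.obj 𝔉.BN)) * g⁻¹) *
      (𝔉.sgpCup ⟨g * (h : Aut (𝔉.base.obj 𝔉.BN)) * g⁻¹, hmem⟩)⁻¹) * 𝔉.sgpCap g =
    𝔉.sgpCap (h : Aut (𝔉.base.obj 𝔉.BN)) * (𝔉.sgpCup h)⁻¹
  rw [hcupEq, map_mul, map_mul, map_inv]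
  group

/-- The Kummer-determined SHAPE of `ν` on the part over `(l·Δ_Θ)_{B_N}` from the Prop. 5.2 (iii) pin
(`ThetaPairKummerClass η ν`), tautological `η` (P55-L02) and centrality (P55-L02b) — the computation of
abc-iut-w5-d020's `isKummerDetermined_of_thetaPair`, stated for the bare isomorphism `ν`.
[cite: MochizukiEtTh2009, Prop 5.5 p.327 (PDF p.101)] -/
theorem kummerShape_of_thetaPair (P : ThetaSubquotientProj 𝔉) {η : 𝔉.HB → 𝔉.lDeltaModN 𝔉.BN}
    {ν : 𝔉.lDeltaModN 𝔉.BN ≃* 𝔉.muTorsion 𝔉.BN 𝔉.N}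
    (hK : FrobenioidThetaBiKummer.ThetaPairKummerClass 𝔉 η ν) (hη : EtaTautological 𝔉 P η)
    (hc : CyclotomeCentralUnderLDelta 𝔉 P) (h : 𝔉.HB)
    (hh : (h : Aut (𝔉.base.obj 𝔉.BN)) ∈ P.pre (𝔉.base.obj 𝔉.BN)) :
    (ν (QuotientGroup.mk (P.proj _ ⟨h, hh⟩)) : Aut 𝔉.BN) =
      𝔉.sgpCap (h : Aut (𝔉.base.obj 𝔉.BN)) * (𝔉.sgpCup h)⁻¹ := by
  obtain ⟨u, hu, hall⟩ := hK
  have hcomm : 𝔉.sgpCap (h : Aut (𝔉.base.obj 𝔉.BN)) * u = u * 𝔉.sgpCap (h : Aut (𝔉.base.obj 𝔉.BN)) :=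
    hc _ hh u hu
  have hcob : 𝔉.sgpCap (h : Aut (𝔉.base.obj 𝔉.BN)) * u * (𝔉.sgpCap (h : Aut (𝔉.base.obj 𝔉.BN)))⁻¹ * u⁻¹
      = 1 := by
    rw [hcomm, mul_inv_cancel_right, mul_inv_cancel]
  rw [hall h, hcob, one_mul, hη h hh]

/-- **P55-L06 from structural laws only** — `TransportIndependent ν` for the isomorphism `ν` pinned by the second
Kummer class (Prop. 5.2 (iii)): the inputs of `transportIndependent_of` with (F) DISCHARGED by
`autFunctorial_sgpCap_of_kummerShape` + `kummerShape_of_thetaPair` and (I) DISCHARGED by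
`lDeltaModNMap_injective_of_reach`.  Remaining named inputs: the Prop. 5.2 (iii) pin `hK`, P55-L02 `hη`, P55-L02b
`hc`, P55-L05 `hreach`, P55-L06b laws `hUc hLc hLi`, T56-L09d `hspec`, coverage `hcov`, and the structural laws
(G) `hgal`, (S) `hsec`, (U) `hUb`, `hproj`, `hcup`.  [cite: MochizukiEtTh2009, Prop 5.5 proof p.328 (PDF p.102)] -/
theorem transportIndependent_of_thetaPair (P : ThetaSubquotientProj 𝔉) {η : 𝔉.HB → 𝔉.lDeltaModN 𝔉.BN}
    {ν : 𝔉.lDeltaModN 𝔉.BN ≃* 𝔉.muTorsion 𝔉.BN 𝔉.N}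
    (hK : FrobenioidThetaBiKummer.ThetaPairKummerClass 𝔉 η ν) (hη : EtaTautological 𝔉 P η)
    (hc : CyclotomeCentralUnderLDelta 𝔉 P) (hreach : BijectivelyReachableFromBN 𝔉)
    (hUc : UnitsPullComp 𝔉) (hLc : LDeltaMapComp 𝔉) (hLi : LDeltaMapId 𝔉) (hspec : UnitsPullSpec 𝔉)
    (hcov : LDeltaCovered 𝔉 P)
    (hgal : ∀ (T : C), 𝔉.IsThetaSaturated T → ∀ (φ φ' : 𝔉.BN ⟶ T), 𝔉.IsLinear φ → 𝔉.IsLinear φ' →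
      ∃ g : Aut (𝔉.base.obj 𝔉.BN), 𝔉.base.map φ' = g.hom ≫ 𝔉.base.map φ)
    (hsec : 𝔉.SgpCapSection)
    (hUb : ∀ {S T : C} (φ ψ : S ⟶ T), 𝔉.IsLinear φ → 𝔉.IsLinear ψ → 𝔉.base.map φ = 𝔉.base.map ψ →
      𝔉.unitsPull φ = 𝔉.unitsPull ψ)
    (hproj : ∀ (g h : Aut (𝔉.base.obj 𝔉.BN)) (hh : h ∈ P.pre (𝔉.base.obj 𝔉.BN)),
      ∃ hgh : g * h * g⁻¹ ∈ P.pre (𝔉.base.obj 𝔉.BN),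
        𝔉.lDeltaMap g.hom (P.proj _ ⟨h, hh⟩) = P.proj _ ⟨g * h * g⁻¹, hgh⟩)
    (hcup : ∀ (g : Aut (𝔉.base.obj 𝔉.BN)) (h : 𝔉.HB),
      (h : Aut (𝔉.base.obj 𝔉.BN)) ∈ P.pre (𝔉.base.obj 𝔉.BN) →
        ∃ hmem : g * (h : Aut (𝔉.base.obj 𝔉.BN)) * g⁻¹ ∈ 𝔉.HB,
          𝔉.sgpCup ⟨g * (h : Aut (𝔉.base.obj 𝔉.BN)) * g⁻¹, hmem⟩ =
            𝔉.sgpCap g * 𝔉.sgpCup h * (𝔉.sgpCap g)⁻¹) :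
    TransportIndependent 𝔉 ν :=
  transportIndependent_of hUc hLc ν hUb hsec hgal
    (autFunctorial_sgpCap_of_kummerShape hspec hsec P hcov ν (kummerShape_of_thetaPair P hK hη hc) hproj hcup)
    (lDeltaModNMap_injective_of_reach hLc hLi hsec hgal hreach)

/-- **[EtTh] Prop. 5.5 (`CyclotomicRigidity P hB`, existence ∧ uniqueness) RE-ASSEMBLED WITHOUT THE P55-L06 INPUT**:
abc-iut-w5-d020's `cyclotomicRigidity_of_sub` with its hypothesis `hind : TransportIndependent ν` DISCHARGED by
`transportIndependent_of_thetaPair`.  Named inputs now: Prop. 5.2 (iii) pin (row 6), P55-L02, P55-L02b, P55-L05,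
P55-L06b + T56-L09d laws (theorems at `ofModel`, abc-iut-w5-d020 `Sec5TransportLaws`), coverage, and the structural
laws (G) Galois base transitivity, (S) `SgpCapSection`, (U) (theorem at `ofModel`, this file), `hproj`
(transport of structure on the theta subquotient), `hcup` (conjugation-equivariance of `s^⊔-gp_N` through
`s^⊓-gp_N` over `(l·Δ_Θ)`).  [cite: MochizukiEtTh2009, Prop 5.5 p.327–328 (PDF pp.101–102)] -/
theorem cyclotomicRigidity_of_laws (P : ThetaSubquotientProj 𝔉) (hB : 𝔉.IsThetaSaturated 𝔉.BN)
    {η : 𝔉.HB → 𝔉.lDeltaModN 𝔉.BN} {ν : 𝔉.lDeltaModN 𝔉.BN ≃* 𝔉.muTorsion 𝔉.BN 𝔉.N}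
    (hK : FrobenioidThetaBiKummer.ThetaPairKummerClass 𝔉 η ν) (hη : EtaTautological 𝔉 P η)
    (hcentral : UnitsCentralUnderLDelta 𝔉 P) (hreach : BijectivelyReachableFromBN 𝔉)
    (hUc : UnitsPullComp 𝔉) (hUi : UnitsPullId 𝔉) (hLc : LDeltaMapComp 𝔉) (hLi : LDeltaMapId 𝔉)
    (hspec : UnitsPullSpec 𝔉) (hcov : LDeltaCovered 𝔉 P)
    (hgal : ∀ (T : C), 𝔉.IsThetaSaturated T → ∀ (φ φ' : 𝔉.BN ⟶ T), 𝔉.IsLinear φ → 𝔉.IsLinear φ' →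
      ∃ g : Aut (𝔉.base.obj 𝔉.BN), 𝔉.base.map φ' = g.hom ≫ 𝔉.base.map φ)
    (hsec : 𝔉.SgpCapSection)
    (hUb : ∀ {S T : C} (φ ψ : S ⟶ T), 𝔉.IsLinear φ → 𝔉.IsLinear ψ → 𝔉.base.map φ = 𝔉.base.map ψ →
      𝔉.unitsPull φ = 𝔉.unitsPull ψ)
    (hproj : ∀ (g h : Aut (𝔉.base.obj 𝔉.BN)) (hh : h ∈ P.pre (𝔉.base.obj 𝔉.BN)),
      ∃ hgh : g * h * g⁻¹ ∈ P.pre (𝔉.base.obj 𝔉.BN),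
        𝔉.lDeltaMap g.hom (P.proj _ ⟨h, hh⟩) = P.proj _ ⟨g * h * g⁻¹, hgh⟩)
    (hcup : ∀ (g : Aut (𝔉.base.obj 𝔉.BN)) (h : 𝔉.HB),
      (h : Aut (𝔉.base.obj 𝔉.BN)) ∈ P.pre (𝔉.base.obj 𝔉.BN) →
        ∃ hmem : g * (h : Aut (𝔉.base.obj 𝔉.BN)) * g⁻¹ ∈ 𝔉.HB,
          𝔉.sgpCup ⟨g * (h : Aut (𝔉.base.obj 𝔉.BN)) * g⁻¹, hmem⟩ =
            𝔉.sgpCap g * 𝔉.sgpCup h * (𝔉.sgpCap g)⁻¹) :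
    CyclotomicRigidity 𝔉 P hB :=
  cyclotomicRigidity_of_sub P hB hK hη hcentral hreach
    (transportIndependent_of_thetaPair P hK hη (cyclotomeCentral_of_unitsCentral 𝔉 hcentral) hreach hUc hLc hLi
      hspec hcov hgal hsec hUb hproj hcup)
    hUc hUi hLc hLi hcov

end Thm56Sub

end ThetaFrobenioid

end Literature.AnabelianGeometry.EtaleTheta
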